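import Summits.AnomalousDissipation.AnomalousDissipation.Theses.CoherentStates

/-!
# AnomalousDissipation / CoherentStates — assembly item `Assembly2` (stmt-AnomalousDissipation-0406)

Route `AnomalousDissipation/CoherentStates`, legacy assembly variant with the Leray–Hopf bridge
written out as a hypothesis:
`(classical global solutions with smooth force are global Leray–Hopf) → CoherentThesis →
AnomalousDissipation`.
Since rev 6 of the route file the deciding theorem `closes : CoherentThesis → AnomalousDissipation`
is proved crux-only (the bridge is the proved Literature theorem
`Literature.Analysis.FunctionSpaces.Torus.IsClassicalNSSolutionOn.isGlobalLerayHopf`), so this item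
is one line from the glue: the bridge hypothesis is simply not needed.
-/

-- `Summit.<Summit>.<Problem>` is the tree's mandated summit-side namespace (CONVENTIONS §2); for this
-- single-conjunct summit the two coincide, so the duplicate is deliberate.
set_option linter.dupNamespace false

namespace Summit.AnomalousDissipation.AnomalousDissipation.Theses.CoherentStates

/-- The legacy assembly variant `Assembly2` of route CoherentStates (item stmt-AnomalousDissipation-0406):
`(classical global solutions with smooth force are global Leray–Hopf) → thesis X → AnomalousDissipation`,
hypothesis 1 being the body of `ClassicalGlobalIsGlobalLerayHopf` and hypothesis 2 the body of
`CoherentThesis`, verbatim. The route file stopped declaring it on 2026-08-16 (multi-assembly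
autofix: duplicate assembly variants dropped, the proved record of the item kept), so it is
re-declared here, with the item's signature verbatim, solely so that its proved record
`coherentStates_assembly2_proof` below keeps elaborating unchanged (a definition, not a cited fact). -/
def Assembly2 : Prop :=
  (∀ (ν : ℝ) (f u : ℝ → UnitAddTorus (Fin 3) → EuclideanSpace ℝ (Fin 3))
      (p : ℝ → UnitAddTorus (Fin 3) → ℝ), 0 < ν →
      Literature.Analysis.FunctionSpaces.Torus.IsClassicalNSSolutionOn Set.univ ν f u p →
      Literature.Analysis.FunctionSpaces.Torus.IsSmoothSpaceTimeOn Set.univ f →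
      Literature.Analysis.FluidPDE.Torus.IsGlobalLerayHopf ν f (u 0) u) →
  (∃ f : UnitAddTorus (Fin 3) → EuclideanSpace ℝ (Fin 3),
      Literature.Analysis.FunctionSpaces.Torus.IsSmooth f ∧
      Literature.Analysis.FunctionSpaces.Torus.IsDivFree f ∧
      Literature.Analysis.FunctionSpaces.Torus.HasZeroMean f ∧
      ∃ (ν τ : ℕ → ℝ) (u : ℕ → ℝ → UnitAddTorus (Fin 3) → EuclideanSpace ℝ (Fin 3))
        (p : ℕ → ℝ → UnitAddTorus (Fin 3) → ℝ),
        (∀ j, 0 < ν j) ∧ Filter.Tendsto ν Filter.atTop (nhds 0) ∧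
        (∀ j, Literature.Analysis.FunctionSpaces.Torus.IsClassicalNSSolutionOn Set.univ (ν j)
            (fun _ => f) (u j) (p j) ∧ 0 < τ j ∧ Function.Periodic (u j) (τ j)) ∧
        (∃ E : ℝ, ∀ j, Literature.Analysis.FluidPDE.meanEnergy (u j) ≤ E) ∧
        ∃ ε : ℝ, 0 < ε ∧ ∀ j, ε ≤ Literature.Analysis.FluidPDE.meanDissipation (ν j) (u j)) →
  AnomalousDissipation

end Summit.AnomalousDissipation.AnomalousDissipation.Theses.CoherentStates

namespace Summit.AnomalousDissipation.AnomalousDissipation.Theorems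

open Summit.AnomalousDissipation.AnomalousDissipation.Theses.CoherentStates

/-- Settles stmt-AnomalousDissipation-0406 (`Assembly2`, assembly of route CoherentStates with the
Leray–Hopf bridge inlined as hypothesis 1): thesis X (hypothesis 2, = `CoherentThesis` verbatim)
already decides `AnomalousDissipation` by the route glue `closes`; the bridge hypothesis is
discarded. [folklore] -/
theorem coherentStates_assembly2_proof :
    Summit.AnomalousDissipation.AnomalousDissipation.Theses.CoherentStates.Assembly2 := by
  unfold Summit.AnomalousDissipation.AnomalousDissipation.Theses.CoherentStates.Assembly2
  intro _ hX
  exact closes hX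

end Summit.AnomalousDissipation.AnomalousDissipation.Theorems
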